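import Summits.QuantumAdvantage.AdviceFreeQNC0.PLDAMSAllDensities
import Mathlib.Analysis.SpecialFunctions.Pow.Asymptotics
import Mathlib.Analysis.SpecialFunctions.Log.Base
import HarnessLib

/-!
# Cell qa-qnc0 (rung F-Q1, line `product`): the PLDAMS ladder of TARGET §18.2, rung by rung

Corollaries of `pldams_allDensities` in the planner's shape `QaQnc0.Product5.PLDAMSAt D` (unfolded,
as in `pldamsLogRung`): `∃ κ₀ > 0, ∃ n₀, ∀ n ≥ n₀, ∀ d ≤ D n, ∀ g ∈ lowDeg 𝔽₂ n d, ∀ r,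
κ₀·#{g ≠ 0} ≤ #{g ≠ 0 ∧ wt ≡ r (mod 3)}`.

* `pldamsAt_of_littleO` : every degree profile `D` with `D n = o(√n)` (i.e. `∀ ε > 0`, eventually
  `D n ≤ ε√n`);
* `pldamsCLog C` : rung 1, `D n = C·⌊log₂ n⌋` (was "OPEN = the first open case", TARGET §18.2);
* `pldamsPolylog C` : rung 2, `D n = ⌊log₂ n⌋^C` (the necessary special case of `LDMAPolylog`);
* `pldamsSqrt` : rung 3 for some `c > 0`, `D n ≤ c√n` (this is `pldams_allDensities` itself, `∀ r` inside).

[cite: Srinivasan2023, Lemma 3.1 (through `relativeHegedus` and `pldams_allDensities`)]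
WHAT THIS IS NOT: `κ₀` absurdly small and not explicit; nothing on `LDMAPolylog` proper or α; no separation.
-/

noncomputable section

namespace Summit.QuantumAdvantage.AdviceFreeQNC0

open Finset Filter Asymptotics
open Literature.Computability.MetaComplexity Literature.Computability.MetaComplexity.Smolensky
open Literature.Computability.MetaComplexity.Hegedus

/-- **PLDAMS along any degree profile `D = o(√n)`.** [cite: Srinivasan2023, Lemma 3.1 (through
`pldams_allDensities`)] -/
theorem pldamsAt_of_littleO (D : ℕ → ℕ)
    (hD : ∀ ε : ℝ, 0 < ε → ∃ n₁ : ℕ, ∀ n : ℕ, n₁ ≤ n → (D n : ℝ) ≤ ε * Real.sqrt n) :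
    ∃ κ₀ : ℝ, 0 < κ₀ ∧ ∃ n₀ : ℕ, ∀ n : ℕ, n₀ ≤ n → ∀ d : ℕ, d ≤ D n →
      ∀ g : CubeFn (ZMod 2) n, g ∈ lowDeg (ZMod 2) n d → ∀ r : ℕ,
        κ₀ * ((univ.filter fun u : Fin n → Bool => g u ≠ 0).card : ℝ) ≤
          ((univ.filter fun u : Fin n → Bool => g u ≠ 0 ∧ wt u % 3 = r % 3).card : ℝ) := by
  obtain ⟨κ, hκ, c, hc, n₀, h⟩ := pldams_allDensities
  obtain ⟨n₁, hn₁⟩ := hD c hc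
  refine ⟨κ, hκ, max n₀ n₁, fun n hn d hd g hg r => ?_⟩
  have hdn : (d : ℝ) ≤ c * Real.sqrt n :=
    le_trans (by exact_mod_cast hd) (hn₁ n (le_trans (le_max_right _ _) hn))
  exact h n (le_trans (le_max_left _ _) hn) r d hdn g hg

/-- `(log x)^C = o(√x)` in the form needed: for every `ε > 0`, eventually (in `n : ℕ`)
`⌊log₂ n⌋^C ≤ ε·√n`. [folklore] -/
private theorem natLog_pow_le_eventually (C : ℕ) (ε : ℝ) (hε : 0 < ε) :
    ∃ n₁ : ℕ, ∀ n : ℕ, n₁ ≤ n → ((Nat.log 2 n : ℝ)) ^ C ≤ ε * Real.sqrt n := by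
  -- `(log x)^C = o(x^{1/2})` over `ℝ`
  have hlo := isLittleO_log_rpow_rpow_atTop (C : ℝ) (by norm_num : (0 : ℝ) < 1 / 2)
  have hL2 : 0 < Real.log 2 := Real.log_pos (by norm_num)
  have hcpos : 0 < ε * Real.log 2 ^ C := mul_pos hε (pow_pos hL2 C)
  have hev := hlo.bound hcpos
  rw [Filter.eventually_atTop] at hev
  obtain ⟨x₀, hx₀⟩ := hev
  refine ⟨max 2 ⌈x₀⌉₊, fun n hn => ?_⟩
  have hn2 : 2 ≤ n := le_trans (le_max_left _ _) hn
  have hnx : x₀ ≤ (n : ℝ) := le_trans (Nat.le_ceil _) (by exact_mod_cast le_trans (le_max_right _ _) hn)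
  have hnR : (1 : ℝ) < n := by exact_mod_cast hn2
  have hb := hx₀ n hnx
  -- unpack the norms
  have hlog0 : 0 ≤ Real.log n := Real.log_nonneg hnR.le
  rw [Real.norm_eq_abs, Real.norm_eq_abs, Real.rpow_natCast,
    abs_of_nonneg (pow_nonneg hlog0 C), abs_of_nonneg (Real.rpow_nonneg (by positivity) _),
    ← Real.sqrt_eq_rpow] at hb
  -- `Nat.log 2 n ≤ log n / log 2`
  have hnat : (Nat.log 2 n : ℝ) ≤ Real.log n / Real.log 2 := by
    have := Real.natLog_le_logb n 2
    rwa [Real.logb] at this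
  have hnat0 : (0 : ℝ) ≤ Nat.log 2 n := Nat.cast_nonneg _
  calc ((Nat.log 2 n : ℝ)) ^ C ≤ (Real.log n / Real.log 2) ^ C := pow_le_pow_left₀ hnat0 hnat C
    _ = Real.log n ^ C / Real.log 2 ^ C := by rw [div_pow]
    _ ≤ (ε * Real.log 2 ^ C * Real.sqrt n) / Real.log 2 ^ C :=
        div_le_div_of_nonneg_right hb (pow_nonneg hL2.le C)
    _ = ε * Real.sqrt n := by field_simp

/-- **Rung 1 (`PLDAMSCLog C`): PLDAMS for `d ≤ C·⌊log₂ n⌋`, every `C`.** [cite: Srinivasan2023,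
Lemma 3.1 (through `pldams_allDensities`)] -/
theorem pldamsCLog (C : ℕ) :
    ∃ κ₀ : ℝ, 0 < κ₀ ∧ ∃ n₀ : ℕ, ∀ n : ℕ, n₀ ≤ n → ∀ d : ℕ, d ≤ C * Nat.log 2 n →
      ∀ g : CubeFn (ZMod 2) n, g ∈ lowDeg (ZMod 2) n d → ∀ r : ℕ,
        κ₀ * ((univ.filter fun u : Fin n → Bool => g u ≠ 0).card : ℝ) ≤
          ((univ.filter fun u : Fin n → Bool => g u ≠ 0 ∧ wt u % 3 = r % 3).card : ℝ) := by
  refine pldamsAt_of_littleO (fun n => C * Nat.log 2 n) fun ε hε => ?_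
  obtain ⟨n₁, hn₁⟩ := natLog_pow_le_eventually 1 (ε / (C + 1)) (by positivity)
  refine ⟨n₁, fun n hn => ?_⟩
  have h := hn₁ n hn
  rw [pow_one] at h
  have hC : (C : ℝ) ≤ C + 1 := by linarith
  push_cast
  calc (C : ℝ) * Nat.log 2 n ≤ (C + 1) * (ε / (C + 1) * Real.sqrt n) :=
        mul_le_mul hC h (Nat.cast_nonneg _) (by positivity)
    _ = ε * Real.sqrt n := by field_simp

/-- **Rung 2 (`PLDAMSPolylog C`): PLDAMS for `d ≤ ⌊log₂ n⌋^C`, every `C` — the necessary special case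
of `LDMAPolylog`.** [cite: Srinivasan2023, Lemma 3.1 (through `pldams_allDensities`)] -/
theorem pldamsPolylog (C : ℕ) :
    ∃ κ₀ : ℝ, 0 < κ₀ ∧ ∃ n₀ : ℕ, ∀ n : ℕ, n₀ ≤ n → ∀ d : ℕ, d ≤ Nat.log 2 n ^ C →
      ∀ g : CubeFn (ZMod 2) n, g ∈ lowDeg (ZMod 2) n d → ∀ r : ℕ,
        κ₀ * ((univ.filter fun u : Fin n → Bool => g u ≠ 0).card : ℝ) ≤
          ((univ.filter fun u : Fin n → Bool => g u ≠ 0 ∧ wt u % 3 = r % 3).card : ℝ) := by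
  refine pldamsAt_of_littleO (fun n => Nat.log 2 n ^ C) fun ε hε => ?_
  obtain ⟨n₁, hn₁⟩ := natLog_pow_le_eventually C ε hε
  exact ⟨n₁, fun n hn => by push_cast; exact hn₁ n hn⟩

/-- **Rung 3 (`PLDAMS(c)` for some `c > 0`): PLDAMS for `d ≤ c·√n`.** [cite: Srinivasan2023, Lemma 3.1
(through `pldams_allDensities`)] -/
theorem pldamsSqrt :
    ∃ c : ℝ, 0 < c ∧ ∃ κ₀ : ℝ, 0 < κ₀ ∧ ∃ n₀ : ℕ, ∀ n : ℕ, n₀ ≤ n → ∀ d : ℕ,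
      (d : ℝ) ≤ c * Real.sqrt n → ∀ g : CubeFn (ZMod 2) n, g ∈ lowDeg (ZMod 2) n d → ∀ r : ℕ,
        κ₀ * ((univ.filter fun u : Fin n → Bool => g u ≠ 0).card : ℝ) ≤
          ((univ.filter fun u : Fin n → Bool => g u ≠ 0 ∧ wt u % 3 = r % 3).card : ℝ) := by
  obtain ⟨κ, hκ, c, hc, n₀, h⟩ := pldams_allDensities
  exact ⟨c, hc, κ, hκ, n₀, fun n hn d hd g hg r => h n hn r d hd g hg⟩

end Summit.QuantumAdvantage.AdviceFreeQNC0
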